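/-
Copyright (c) 2026 the pub-hodgecm-mathlib formalisation cell (harness21).  Prover seat hodgecm-mathlib-K2E5-p12 (g2), HCML Track B «K2-LIT», h413 =
`stmt-HodgeConjecture-24833`, line `K2_E3_EllipticInputs`, unit U3b, sub-line (ii♭-H) «RANK-ONE CAYLEY ROAD», letter (SC₂) — FILE 1 of 3: the rank-one model
algebra (transvections of `U(σ, J₀)(K)`, `J₀ = antidiag(1, 1)`).  2026-09-04.
-/
import Literature.NumberTheory.Automorphic.UnitaryTwoUnipotentClasses   -- ★ (F0P3a-p08): `exists_conj_coe_eq_lineUnipotent`, `mem_unitaryGroupOfForm_iff_of_coe_eq_lineUnipotent`, `exists_units_coe_eq_lineUnipotent`, `exists_units_coe_eq_torusEltTwo`, `torusEltTwo_mem_unitaryGroupOfForm`, `coe_torusEltTwo_conj_lineUnipotent`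
import HarnessLib

/-!
# h413 ∕ K2-LIT, line `K2_E3_EllipticInputs`, unit U3b, (ii♭-H) (SC₂), FILE 1: TRANSVECTIONS OF THE RANK-ONE QUASI-SPLIT UNITARY GROUP `U(σ, J₀)(K)`

Cell `pub/hodgecm-mathlib`, crux H413 = `stmt-HodgeConjecture-24833`, route of record `HCCMUnconditional`; chair K2-lead (g0), line lead (ii′) K2E4-p06 (g2), dealers
K2E3-plan ∕ K2E5-plan.  THEOREMS ONLY (no `def`, no `instance`, no `notation`, no named-fact hypothesis, no `sorry`); imports = ★ + HarnessLib; lane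
`--supports stmt-HodgeConjecture-24833 --as helper` (count-neutral).

PURPOSE.  The letter (SC₂) — the hypothesis `hSC` of ★ p855890 `K2E3CayleyScalingRankOnePackage.psiPackage_of_scalingLaw_local_two` — is the SCALING LAW of the
unipotent orbital integrals of `U(Φ₂)(L⁺_v)` under the Cayley scaling.  In rank one every unipotent `u ≠ 1` is a TRANSVECTION (`(u − 1)² = 0`), and the whole law
reduces to linear algebra in the split hermitian PLANE `(K², B₀)`, `B₀(x, y) = σ(x₀)y₁ + σ(x₁)y₀`, `J₀ = antidiag(1, 1)`, over a field `K` with an involution `σ`.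
This file supplies that algebra, the `N = 2` twin of ★ `UnitaryThreeUnipotentConjugacy` ([Rogawski1990] §3.9) and of ★ p855558 §2 (K2E4-p03):

The named elements `n(t) = !![1, t; 0, 1]` (`∈ U ⟺ σt + t = 0`), `d(z) = diag(z, (σz)⁻¹) ∈ U`, the identity `d(z) n(t) d(z)⁻¹ = n(zσz·t)` and the normal form
«every unipotent of `U` is `U`-conjugate to some `n(t)`» are ★ `UnitaryTwoUnipotentClasses` (F0P3a-p08) and are CITED, not retyped.  This file adds:

* §1 `U(σ, J₀)(K)` IN COORDINATES: `g ∈ U ⟺` four bilinear identities in the entries of `g` (`transpose_map_mul_antidiagonal_mul`, `mem_iff_entries`), and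
  `1 + s•(n(τ) − 1) = n(sτ)` (the Cayley dilation in normal form).
* §2 THE NORMAL FORM OF A TRANSVECTION `u ≠ 1`: `k u k⁻¹ = n(τ)` with `τ ≠ 0`, `στ = −τ` (★ `exists_conj_coe_eq_lineUnipotent` + `u ≠ 1`).
* §3 THE CENTRALISER OF `n(τ)` (`τ ≠ 0`): `z ∈ Z(n(τ)) ⟺ z = !![a, b; 0, a]`, and then `σa·a = 1`, `σb·a + σa·b = 0`; the WEIGHT `θ(z) = b·σa` is additive on
  `Z(n(τ))`, `σ`-skew, and is multiplied by `t²` under `Ad d(t)` (`σt = t`) — so `Z(n(τ)) = E¹·{n(b)} ≅ E¹ × 𝔤₋` is abelian and `Ad d(t)` dilates its unipotent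
  line by `t²` (HC's `d(u) = 2` in rank one: ONE factor `[𝔤₋(𝒪) : t²𝔤₋(𝒪)]`, counted in FILE 2).

HONEST LABEL.  HC_CM is proved only modulo the 7 printed citations (2 remaining named inputs: hLiu418 = `stmt-HodgeConjecture-24832`, h413 =
`stmt-HodgeConjecture-24833`) until rung 0 closes; this file is a count-neutral helper of the U3b (ii♭-H) sub-line.

## References
* [Rogawski1990] J. D. Rogawski, *Automorphic Representations of Unitary Groups in Three Variables*, Ann. of Math. Stud. 123 (1990), §3.9 p. 32 (unipotent classes
  via an isotropic fixed line), §8.1 Prop. 8.1.2 (b) p. 114 (the dilation), §1.10 p. 9 (`n`, `d`).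
* [HarishChandra1999AdmissibleDistributions] Harish-Chandra (DeBacker–Sally), *Admissible Invariant Distributions on Reductive p-adic Groups*, ULS 16 (1999), §3.1 Lemma 3.2.
* [PlatonovRapinchuk1994] V. Platonov, A. Rapinchuk, *Algebraic Groups and Number Theory* (1994), §2.3 (unitary groups of hermitian forms in coordinates).
-/

set_option autoImplicit false
set_option linter.dupNamespace false  -- the mandated namespace repeats the single-problem summit's segment (`HodgeConjecture.HodgeConjecture`)

open Matrix
open scoped Matrix MatrixGroups
open Literature.NumberTheory.Automorphic Literature.NumberTheory.Automorphic.UnitaryGroup Literature.NumberTheory.Automorphic.HermitianLattice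

namespace Summit.HodgeConjecture.HodgeConjecture.Cruxes.H413.K2E3RankOneTransvectionNormalForm

variable {K : Type*} [Field K] (σ : K →+* K)

/-! ## §1 `U(σ, J₀)(K)` in coordinates -/

omit σ in
/-- `J₀ = antidiag(1, 1) = !![0, 1; 1, 0]` over `K`. [cite: Rogawski1990, §1.10 p. 9] -/
theorem antidiagonal_two_over : (StdForm.antidiagonal 2).over K = !![0, 1; 1, 0] := by
  ext i j
  fin_cases i <;> fin_cases j <;> simp [StdForm.over, StdForm.antidiagonal_J_apply]

/-- **The unitarity matrix `(g^σ)ᵀ J₀ g` of a `2 × 2` matrix `g`, in coordinates.** [cite: PlatonovRapinchuk1994, §2.3] -/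
theorem transpose_map_mul_antidiagonal_mul (g : Matrix (Fin 2) (Fin 2) K) :
    (g.map σ)ᵀ * (StdForm.antidiagonal 2).over K * g =
      !![σ (g 0 0) * g 1 0 + σ (g 1 0) * g 0 0, σ (g 0 0) * g 1 1 + σ (g 1 0) * g 0 1;
         σ (g 0 1) * g 1 0 + σ (g 1 1) * g 0 0, σ (g 0 1) * g 1 1 + σ (g 1 1) * g 0 1] := by
  rw [antidiagonal_two_over]
  ext i j
  fin_cases i <;> fin_cases j <;> simp [Matrix.mul_apply, Fin.sum_univ_two] <;> ring

/-- **`g ∈ U(σ, J₀)(K)` ⟺ the four coordinate identities** `σg₀₀g₁₀ + σg₁₀g₀₀ = 0`, `σg₀₀g₁₁ + σg₁₀g₀₁ = 1`, `σg₀₁g₁₀ + σg₁₁g₀₀ = 1`, `σg₀₁g₁₁ + σg₁₁g₀₁ = 0`.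
[cite: PlatonovRapinchuk1994, §2.3] -/
theorem mem_iff_entries (g : GL (Fin 2) K) :
    g ∈ unitaryGroupOfForm σ ((StdForm.antidiagonal 2).over K) ↔
      σ ((g : Matrix (Fin 2) (Fin 2) K) 0 0) * (g : Matrix (Fin 2) (Fin 2) K) 1 0 + σ ((g : Matrix (Fin 2) (Fin 2) K) 1 0) * (g : Matrix (Fin 2) (Fin 2) K) 0 0 = 0 ∧
      σ ((g : Matrix (Fin 2) (Fin 2) K) 0 0) * (g : Matrix (Fin 2) (Fin 2) K) 1 1 + σ ((g : Matrix (Fin 2) (Fin 2) K) 1 0) * (g : Matrix (Fin 2) (Fin 2) K) 0 1 = 1 ∧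
      σ ((g : Matrix (Fin 2) (Fin 2) K) 0 1) * (g : Matrix (Fin 2) (Fin 2) K) 1 0 + σ ((g : Matrix (Fin 2) (Fin 2) K) 1 1) * (g : Matrix (Fin 2) (Fin 2) K) 0 0 = 1 ∧
      σ ((g : Matrix (Fin 2) (Fin 2) K) 0 1) * (g : Matrix (Fin 2) (Fin 2) K) 1 1 + σ ((g : Matrix (Fin 2) (Fin 2) K) 1 1) * (g : Matrix (Fin 2) (Fin 2) K) 0 1 = 0 := by
  rw [mem_unitaryGroupOfForm_iff, transpose_map_mul_antidiagonal_mul, antidiagonal_two_over]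
  constructor
  · intro h
    exact ⟨by simpa using congr_fun (congr_fun h 0) 0, by simpa using congr_fun (congr_fun h 0) 1,
      by simpa using congr_fun (congr_fun h 1) 0, by simpa using congr_fun (congr_fun h 1) 1⟩
  · rintro ⟨h00, h01, h10, h11⟩
    ext i j
    fin_cases i <;> fin_cases j <;> simp [h00, h01, h10, h11]

omit σ in
/-- `1 + s•(n(τ) − 1) = n(sτ)`: the Cayley dilation of a transvection in normal form. [cite: HarishChandra1999AdmissibleDistributions, §3.1 Lemma 3.2] -/
theorem one_add_smul_upper_sub_one (s τ : K) :
    (1 : Matrix (Fin 2) (Fin 2) K) + s • ((!![1, τ; 0, 1] : Matrix (Fin 2) (Fin 2) K) - 1) = !![1, s * τ; 0, 1] := by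
  ext i j
  fin_cases i <;> fin_cases j <;> simp

/-! ## §2 The normal form of a transvection -/

/-- **THE NORMAL FORM OF A TRANSVECTION (rank one).**  On `U(σ, J₀)(K)` (`σ` an involution): for every `u ∈ U` with `(u − 1)² = 0`, `u ≠ 1`, there are `k ∈ U` and
`τ ≠ 0` with `στ = −τ` and `k u k⁻¹ = n(τ)` — ★ `exists_conj_coe_eq_lineUnipotent` (every unipotent of `U(Φ₂)` is conjugate to some `n(t)`, `σt + t = 0`), and
`τ ≠ 0` because `u ≠ 1`. [cite: Rogawski1990, §3.9 p. 32] -/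
theorem exists_conj_coe_eq_upper_of_sq_eq_zero (hσ : ∀ a : K, σ (σ a) = a) {u : GL (Fin 2) K}
    (hu : u ∈ unitaryGroupOfForm σ ((StdForm.antidiagonal 2).over K))
    (hsq : ((u : Matrix (Fin 2) (Fin 2) K) - 1) * ((u : Matrix (Fin 2) (Fin 2) K) - 1) = 0) (hne : (u : Matrix (Fin 2) (Fin 2) K) ≠ 1) :
    ∃ k : GL (Fin 2) K, k ∈ unitaryGroupOfForm σ ((StdForm.antidiagonal 2).over K) ∧ ∃ τ : K, τ ≠ 0 ∧ σ τ = -τ ∧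
      ((k * u * k⁻¹ : GL (Fin 2) K) : Matrix (Fin 2) (Fin 2) K) = !![1, τ; 0, 1] := by
  obtain ⟨k, hk, τ, hστ, hmat⟩ := exists_conj_coe_eq_lineUnipotent σ hσ hu ⟨2, by rw [pow_two, hsq]⟩
  refine ⟨k, hk, τ, ?_, eq_neg_of_add_eq_zero_left hστ, hmat⟩
  -- `τ ≠ 0` since `u ≠ 1`
  intro hτ
  apply hne
  have h1 : k * u * k⁻¹ = 1 := by
    refine Units.ext ?_
    rw [hmat, hτ, Units.val_one]
    ext i j
    fin_cases i <;> fin_cases j <;> simp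
  have hu1 : u = 1 := by
    calc u = k⁻¹ * (k * u * k⁻¹) * k := by group
      _ = 1 := by rw [h1, mul_one, inv_mul_cancel]
  rw [hu1, Units.val_one]

/-! ## §3 The centraliser of `n(τ)` and its weight -/

section Centralizer

variable {J : Matrix (Fin 2) (Fin 2) K}

/-- Products in `U(σ, J)(K)` are matrix products. [folklore] -/
theorem coe_mul_coe (x y : ↥(unitaryGroupOfForm σ J)) :
    (((x * y : ↥(unitaryGroupOfForm σ J)) : GL (Fin 2) K) : Matrix (Fin 2) (Fin 2) K) =
      ((x : GL (Fin 2) K) : Matrix (Fin 2) (Fin 2) K) * ((y : GL (Fin 2) K) : Matrix (Fin 2) (Fin 2) K) := by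
  rw [Subgroup.coe_mul, Units.val_mul]

/-- Commuting in `U(σ, J)(K)` is commuting of matrices. [folklore] -/
theorem commute_iff_coe (z n : ↥(unitaryGroupOfForm σ J)) :
    z * n = n * z ↔ ((z : GL (Fin 2) K) : Matrix (Fin 2) (Fin 2) K) * ((n : GL (Fin 2) K) : Matrix (Fin 2) (Fin 2) K) =
      ((n : GL (Fin 2) K) : Matrix (Fin 2) (Fin 2) K) * ((z : GL (Fin 2) K) : Matrix (Fin 2) (Fin 2) K) := by
  rw [← coe_mul_coe, ← coe_mul_coe]
  exact ⟨fun h => by rw [h], fun h => Subtype.ext (Units.ext h)⟩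

/-- **THE CENTRALISER OF `n(τ)`, `τ ≠ 0`**: `z ∈ Z(n(τ)) ⟺ z₁₀ = 0 ∧ z₁₁ = z₀₀` (`z` commutes with `τE₀₁`). [cite: Rogawski1990, §3.9 p. 32] -/
theorem mem_centralizer_iff_of_coe_eq_upper {n : ↥(unitaryGroupOfForm σ J)} {τ : K} (hn : ((n : GL (Fin 2) K) : Matrix (Fin 2) (Fin 2) K) = !![1, τ; 0, 1])
    (hτ : τ ≠ 0) (z : ↥(unitaryGroupOfForm σ J)) :
    z ∈ Subgroup.centralizer ({n} : Set ↥(unitaryGroupOfForm σ J)) ↔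
      ((z : GL (Fin 2) K) : Matrix (Fin 2) (Fin 2) K) 1 0 = 0 ∧ ((z : GL (Fin 2) K) : Matrix (Fin 2) (Fin 2) K) 1 1 = ((z : GL (Fin 2) K) : Matrix (Fin 2) (Fin 2) K) 0 0 := by
  rw [Subgroup.mem_centralizer_singleton_iff, commute_iff_coe, hn]
  set Z : Matrix (Fin 2) (Fin 2) K := ((z : GL (Fin 2) K) : Matrix (Fin 2) (Fin 2) K) with hZ
  constructor
  · intro h
    have e00 := congr_fun (congr_fun h 0) 0
    have e01 := congr_fun (congr_fun h 0) 1
    simp [Matrix.mul_apply, Fin.sum_univ_two] at e00 e01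
    -- `e00 : τ = 0 ∨ Z 1 0 = 0`, `e01 : Z 0 0 * τ + Z 0 1 = Z 0 1 + τ * Z 1 1`
    have h10 : Z 1 0 = 0 := e00.resolve_left hτ
    refine ⟨h10, ?_⟩
    have : τ * (Z 1 1 - Z 0 0) = 0 := by linear_combination (-1 : K) * e01
    rcases mul_eq_zero.1 this with h | h
    · exact absurd h hτ
    · exact (sub_eq_zero.1 h)
  · rintro ⟨h10, h11⟩
    ext i j
    fin_cases i <;> fin_cases j <;> simp [Matrix.mul_apply, Fin.sum_univ_two, h10, h11, mul_comm, add_comm]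

end Centralizer

/-- **THE SHAPE OF A CENTRALISER ELEMENT**: for `z ∈ U(σ, J₀)(K)` upper triangular with equal diagonal `a` and corner `b`: `σa·a = 1` and `σb·a + σa·b = 0`
(the `(0,1)` and `(1,1)` unitarity identities). [cite: Rogawski1990, §3.9 p. 32] -/
theorem norm_eq_one_of_upper {z : GL (Fin 2) K} (hz : z ∈ unitaryGroupOfForm σ ((StdForm.antidiagonal 2).over K))
    (h10 : (z : Matrix (Fin 2) (Fin 2) K) 1 0 = 0) (h11 : (z : Matrix (Fin 2) (Fin 2) K) 1 1 = (z : Matrix (Fin 2) (Fin 2) K) 0 0) :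
    σ ((z : Matrix (Fin 2) (Fin 2) K) 0 0) * (z : Matrix (Fin 2) (Fin 2) K) 0 0 = 1 ∧
      σ ((z : Matrix (Fin 2) (Fin 2) K) 0 1) * (z : Matrix (Fin 2) (Fin 2) K) 0 0 + σ ((z : Matrix (Fin 2) (Fin 2) K) 0 0) * (z : Matrix (Fin 2) (Fin 2) K) 0 1 = 0 := by
  obtain ⟨-, h01, -, h11'⟩ := (mem_iff_entries σ z).1 hz
  rw [h10, h11, map_zero, zero_mul, add_zero] at h01
  rw [h11] at h11'
  exact ⟨h01, h11'⟩

/-- **THE WEIGHT IS ADDITIVE**: for `z, z'` upper triangular with equal diagonals of `σ`-norm one, `θ(zz') = θ(z) + θ(z')` where `θ(z) = z₀₁·σz₀₀`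
(`(zz')₀₁ = z₀₀z'₀₁ + z₀₁z'₀₀`, `(zz')₀₀ = z₀₀z'₀₀`, `σa·a = 1`). [cite: Rogawski1990, §3.9 p. 32] -/
theorem weight_mul (Z Z' : Matrix (Fin 2) (Fin 2) K) (h10 : Z 1 0 = 0) (h11 : Z 1 1 = Z 0 0) (h10' : Z' 1 0 = 0) (h11' : Z' 1 1 = Z' 0 0)
    (hn : σ (Z 0 0) * Z 0 0 = 1) (hn' : σ (Z' 0 0) * Z' 0 0 = 1) :
    (Z * Z') 0 1 * σ ((Z * Z') 0 0) = Z 0 1 * σ (Z 0 0) + Z' 0 1 * σ (Z' 0 0) ∧ (Z * Z') 1 0 = 0 ∧ (Z * Z') 1 1 = (Z * Z') 0 0 := by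
  refine ⟨?_, ?_, ?_⟩
  · simp only [Matrix.mul_apply, Fin.sum_univ_two, h10', h11', mul_zero, add_zero, map_mul]
    linear_combination (Z' 0 1 * σ (Z' 0 0)) * hn + (Z 0 1 * σ (Z 0 0)) * hn'
  · simp only [Matrix.mul_apply, Fin.sum_univ_two, h10, h10', h11, mul_zero, zero_mul, add_zero]
  · simp only [Matrix.mul_apply, Fin.sum_univ_two, h10, h10', h11, h11', zero_mul, add_zero, zero_add, mul_comm]

/-- **THE WEIGHT IS `σ`-SKEW**: `σ(b·σa) = −b·σa` when `σb·a + σa·b = 0` (`σ` an involution). [cite: Rogawski1990, §3.9 p. 32] -/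
theorem weight_skew (hσ : ∀ x : K, σ (σ x) = x) {a b : K} (h : σ b * a + σ a * b = 0) : σ (b * σ a) = -(b * σ a) := by
  rw [map_mul, hσ]
  linear_combination h

/-- **THE TORUS ACTS ON THE CENTRALISER WITH WEIGHT `t²`**: for `σt = t ≠ 0` and the ★ torus element `d(t) = diag(t, (σt)⁻¹)`:
`d(t) · !![a, b; 0, a] · d(t)⁻¹ = !![a, t²b; 0, a]`. [cite: HarishChandra1999AdmissibleDistributions, §3.1 Lemma 3.2] [cite: Rogawski1990, §8.1 Prop. 8.1.2 (b) p. 114] -/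
theorem coe_torusEltTwo_conj_upper {t : K} (ht : t ≠ 0) (hσt : σ t = t) {d z : GL (Fin 2) K}
    (hd : (d : Matrix (Fin 2) (Fin 2) K) = Matrix.diagonal ![t, (σ t)⁻¹]) (hd' : ((d⁻¹ : GL (Fin 2) K) : Matrix (Fin 2) (Fin 2) K) = Matrix.diagonal ![t⁻¹, σ t])
    {a b : K} (hz : (z : Matrix (Fin 2) (Fin 2) K) = !![a, b; 0, a]) :
    ((d * z * d⁻¹ : GL (Fin 2) K) : Matrix (Fin 2) (Fin 2) K) = !![a, t * t * b; 0, a] := by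
  rw [Units.val_mul, Units.val_mul, hd, hz, hd', hσt]
  ext i j
  fin_cases i <;> fin_cases j
  · simp [Matrix.mul_apply, Matrix.diagonal]
    rw [mul_comm t a, mul_inv_cancel_right₀ ht]
  · simp [Matrix.mul_apply, Matrix.diagonal]
    ring
  · simp [Matrix.mul_apply, Matrix.diagonal]
  · simp [Matrix.mul_apply, Matrix.diagonal]
    rw [mul_comm t⁻¹ a, inv_mul_cancel_right₀ ht]

/-- The inverse of an upper triangular `Z = !![a, b; 0, a]` with `a ≠ 0` is `!![a⁻¹, −b·a⁻¹·a⁻¹; 0, a⁻¹]` (used for integrality of `z⁻¹`). [folklore] -/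
theorem upper_mul_eq_one {a : K} (ha : a ≠ 0) (b : K) :
    (!![a, b; 0, a] : Matrix (Fin 2) (Fin 2) K) * !![a⁻¹, -(b * a⁻¹ * a⁻¹); 0, a⁻¹] = 1 := by
  ext i j
  fin_cases i <;> fin_cases j <;> simp [Matrix.mul_apply, Fin.sum_univ_two, ha] ; field_simp ; ring

/-- A `2 × 2` matrix with `Z₁₀ = 0`, `Z₁₁ = Z₀₀` IS `!![Z₀₀, Z₀₁; 0, Z₀₀]`. [folklore] -/
theorem eq_upper_of_entries (Z : Matrix (Fin 2) (Fin 2) K) (h10 : Z 1 0 = 0) (h11 : Z 1 1 = Z 0 0) : Z = !![Z 0 0, Z 0 1; 0, Z 0 0] := by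
  ext i j
  fin_cases i <;> fin_cases j
  · simp
  · simp
  · simpa using h10
  · simpa using h11

end Summit.HodgeConjecture.HodgeConjecture.Cruxes.H413.K2E3RankOneTransvectionNormalForm
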